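import Summits.ResolutionOfSingularities.ResolutionOfSingularities.Theorems.FrobeniusLadderFInjectiveMacaulayficationGradedDomainCoaction
import Summits.ResolutionOfSingularities.ResolutionOfSingularities.Theorems.FrobeniusLadderFInjectiveMacaulayficationGradedChartIso
import Literature.AlgebraicGeometry.Resolution.AffineBlowupAlgebra
import HarnessLib

/-!
# The weighted blow-up chart of `k[X]/J` is the non-negative part of `(k[X]/J)[1/u]` (crux `FInjectiveMacaulayfication`, line H4-gd, piece G2ᵍa)

Support file for crux stmt-ResolutionOfSingularities-15315 (`FrobeniusLadder.FInjectiveMacaulayfication`), line (H4-gd) THE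
GRADED ENGINE FOR A POSITIVELY GRADED AFFINE DOMAIN OF ANY EMBEDDING CODIMENSION (CRUX-PLAN w45a v7 R7.6, typed target
`stub_gradedDomainConeFiModel`; seat res-L1-w45a-stub-2). [OURS · L1 W4.5a] AI-written; AI review is weaker than expert review.
No statement of Hironaka2017 is used; no external fact is consumed.

This is the generalisation of `…GradedChartIso` (res-L1-w45a-lead-1, H-G2a, hypersurface case `J = (f)`) from `k[X]/(f)` to
`k[X]/J` for an ARBITRARY ideal `J` (no homogeneity, primality or reducedness is used in this file: everything is stated for a
ring map `λ` satisfying `hlam`). Setting as in `…GradedDomainCoaction`: weights `w`, `R = k[X]/J`, `u = ā₀` homogeneous of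
weight `N`, `L = R[1/u]` with its coaction `λ : L → L[T,T⁻¹]`, and the weighted blow-up centre `I_N = (monomials of weight ≥ N)`.
* `coaction_mem_range_toLaurent_of_mem_blowupAlgebra` — the chart `C = R[I_N R/u] ⊆ L` lies in the NON-NEGATIVE part
  `L_{≥ 0} = λ⁻¹(L[T])`;
* `mem_blowupAlgebra_of_coaction_mem_range` — conversely `L_{≥ 0} ⊆ C`, by the VERONESE SATURATION hypothesis
  (`x̄^b ∈ I_N^K` whenever `wt b ≥ K N`);
* `exists_degreeZeroSubalgebra` — the `k`-subalgebra `T₀ ⊆ L[s]` of polynomials `∑ ℓᵢ sⁱ` with `ℓᵢ` homogeneous of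
  degree `i` (the degree-`0` part of the extended Rees ring `L[s]`, `deg s = -1`);
* `exists_chartIso` — `ι : C ≃ₐ[k] T₀`, `c ↦ ∑ᵢ cᵢ sⁱ`, with `λ c = ι c` in `L[T,T⁻¹]` and `ι(u) = (u/1)·s^N`.
The proofs are those of `…GradedChartIso` verbatim with `Ideal.span {f}` replaced by `J` (its generic Laurent lemmas
`coeff_toLaurent_natCast`, `toLaurent_eq_sum`, `eq_zero_of_neg_support_of_mem_range` are imported from there).
No definitions, no named facts. [folklore]
-/

set_option linter.dupNamespace false

noncomputable section

open LaurentPolynomial Literature.AlgebraicGeometry.Resolution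

namespace Summit.ResolutionOfSingularities.ResolutionOfSingularities.Theorems.FInjectiveMacaulayfication.GradedDomainChartIso

open Summit.ResolutionOfSingularities.ResolutionOfSingularities.Theorems.FInjectiveMacaulayfication.GradedDomainCoaction

variable {k : Type} [Field k] {n : ℕ} (w : Fin n → ℕ) (J : Ideal (MvPolynomial (Fin n) k))
variable (u : MvPolynomial (Fin n) k ⧸ J) {N : ℕ} {a₀ : MvPolynomial (Fin n) k}
  (ha₀ : MvPolynomial.IsWeightedHomogeneous w a₀ N) (hu : Ideal.Quotient.mk J a₀ = u)
variable (lam : Localization.Away u →+* (Localization.Away u)[T;T⁻¹])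
variable (hlam : ∀ a : MvPolynomial (Fin n) k,
        lam (algebraMap (MvPolynomial (Fin n) k ⧸ J) _ (Ideal.Quotient.mk J a)) =
          MvPolynomial.aeval (fun j : Fin n => C (algebraMap (MvPolynomial (Fin n) k ⧸ J)
            (Localization.Away u) (Ideal.Quotient.mk J (MvPolynomial.X j))) * T (w j : ℤ)) a)

/-! ## The chart lies in the non-negative part -/

/-- The coaction of a polynomial class `ā/1` is a polynomial in `T` (no negative exponents). [folklore] -/
theorem aeval_mem_range_toLaurent (a : MvPolynomial (Fin n) k) :
    MvPolynomial.aeval (fun j : Fin n => C (algebraMap (MvPolynomial (Fin n) k ⧸ J)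
        (Localization.Away u) (Ideal.Quotient.mk J (MvPolynomial.X j))) * T (w j : ℤ)) a ∈
      Set.range (Polynomial.toLaurent : Polynomial (Localization.Away u) → (Localization.Away u)[T;T⁻¹]) := by
  classical
  refine ⟨∑ b ∈ a.support, Polynomial.C (algebraMap _ (Localization.Away u)
    (Ideal.Quotient.mk J (MvPolynomial.monomial b (MvPolynomial.coeff b a)))) *
      Polynomial.X ^ (Finsupp.weight w b), ?_⟩
  conv_rhs => rw [MvPolynomial.as_sum a]
  rw [map_sum, map_sum]
  refine Finset.sum_congr rfl fun b _ => ?_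
  rw [Polynomial.toLaurent_C_mul_X_pow, aeval_monomial_eq]

section
include ha₀ hu hlam

/-- **The chart lies in the non-negative part**: for `x` in the affine blow-up algebra `R[I_N R/u]`
(`I_N` = monomials of weight `≥ N`), `λ x` has no negative exponents. The non-negative part is an `R`-subalgebra
of `L`, and each generator `ā/u`, `a ∈ I_N`, maps to `(a(x̄ⱼT^{wⱼ})·T^{-N})·(1/u)` with the first factor a
polynomial in `T` because every monomial of `a` has weight `≥ N`. [folklore] -/
theorem coaction_mem_range_toLaurent_of_mem_blowupAlgebra {x : Localization.Away u}
    (hx : x ∈ blowupAlgebra ((Ideal.span {m : MvPolynomial (Fin n) k | ∃ b : Fin n →₀ ℕ, N ≤ Finsupp.weight w b ∧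
      m = MvPolynomial.monomial b 1}).map (Ideal.Quotient.mk J)) u) :
    lam x ∈ Set.range (Polynomial.toLaurent : Polynomial (Localization.Away u) → (Localization.Away u)[T;T⁻¹]) := by
  -- the non-negative part, as an `R`-subalgebra of `L`
  let Lpos : Subalgebra (MvPolynomial (Fin n) k ⧸ J) (Localization.Away u) :=
    { carrier := {x | lam x ∈ Set.range (Polynomial.toLaurent : Polynomial (Localization.Away u) → (Localization.Away u)[T;T⁻¹])}
      mul_mem' := by
        rintro x y ⟨P, hP⟩ ⟨Q, hQ⟩
        exact ⟨P * Q, by rw [map_mul, hP, hQ, map_mul]⟩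
      one_mem' := ⟨1, by rw [map_one, map_one]⟩
      add_mem' := by
        rintro x y ⟨P, hP⟩ ⟨Q, hQ⟩
        exact ⟨P + Q, by rw [map_add, hP, hQ, map_add]⟩
      zero_mem' := ⟨0, by rw [map_zero, map_zero]⟩
      algebraMap_mem' := fun r => by
        obtain ⟨a, rfl⟩ := Ideal.Quotient.mk_surjective r
        show lam (algebraMap _ _ (Ideal.Quotient.mk J a)) ∈
          Set.range (Polynomial.toLaurent : Polynomial (Localization.Away u) → (Localization.Away u)[T;T⁻¹])
        rw [hlam]
        exact aeval_mem_range_toLaurent w J u a }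
  suffices h : blowupAlgebra ((Ideal.span {m : MvPolynomial (Fin n) k | ∃ b : Fin n →₀ ℕ, N ≤ Finsupp.weight w b ∧
      m = MvPolynomial.monomial b 1}).map (Ideal.Quotient.mk J)) u ≤ Lpos from h hx
  refine Algebra.adjoin_le ?_
  rintro _ ⟨x, hxI, rfl⟩
  show lam (algebraMap _ _ x * IsLocalization.Away.invSelf u) ∈
    Set.range (Polynomial.toLaurent : Polynomial (Localization.Away u) → (Localization.Away u)[T;T⁻¹])
  rw [Ideal.mem_map_iff_of_surjective _ Ideal.Quotient.mk_surjective] at hxI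
  obtain ⟨a, ha, rfl⟩ := hxI
  -- `a(x̄ⱼT^{wⱼ}) = y · T^N` with `y` a polynomial in `T`
  have key : ∃ y ∈ Set.range (Polynomial.toLaurent : Polynomial (Localization.Away u) → (Localization.Away u)[T;T⁻¹]),
      MvPolynomial.aeval (fun j : Fin n => C (algebraMap (MvPolynomial (Fin n) k ⧸ J)
        (Localization.Away u) (Ideal.Quotient.mk J (MvPolynomial.X j))) * T (w j : ℤ)) a = y * T (N : ℤ) := by
    refine Submodule.span_induction ?_ ?_ ?_ ?_ ha
    · rintro _ ⟨b, hb, rfl⟩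
      refine ⟨Polynomial.toLaurent (Polynomial.C (algebraMap _ (Localization.Away u)
        (Ideal.Quotient.mk J (MvPolynomial.monomial b 1))) * Polynomial.X ^ (Finsupp.weight w b - N)),
        ⟨_, rfl⟩, ?_⟩
      rw [aeval_monomial_eq, Polynomial.toLaurent_C_mul_X_pow, mul_assoc, ← T_add]
      congr 2
      rw [Nat.cast_sub hb]
      ring
    · exact ⟨0, ⟨0, map_zero _⟩, by simp⟩
    · rintro x y - - ⟨px, ⟨Px, hPx⟩, hx⟩ ⟨py, ⟨Py, hPy⟩, hy⟩
      exact ⟨px + py, ⟨Px + Py, by rw [map_add, hPx, hPy]⟩, by rw [map_add, hx, hy, add_mul]⟩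
    · rintro r x - ⟨px, ⟨Px, hPx⟩, hx⟩
      obtain ⟨Pr, hPr⟩ := aeval_mem_range_toLaurent w J u r
      exact ⟨_ * px, ⟨Pr * Px, by rw [map_mul, hPr, hPx]⟩, by rw [smul_eq_mul, map_mul, hx, mul_assoc]⟩
  obtain ⟨y, ⟨Py, hPy⟩, hy⟩ := key
  refine ⟨Py * Polynomial.C (IsLocalization.Away.invSelf u), ?_⟩
  show Polynomial.toLaurent (Py * Polynomial.C _) = lam (_ * _)
  rw [map_mul, map_mul, hlam, hy, coaction_invSelf w J u ha₀ hu lam hlam, Polynomial.toLaurent_C, hPy,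
    mul_mul_mul_comm, ← T_add, add_neg_cancel, T_zero, mul_one]

end

/-! ## Veronese saturation: the non-negative part lies in the chart -/

omit hlam in
/-- Every element of `L = R[1/u]` is `(ā/1)·(1/u)^j` for a polynomial `a` and some `j`. [folklore] -/
theorem exists_eq_algebraMap_mk_mul_invSelf_pow (x : Localization.Away u) :
    ∃ (j : ℕ) (a : MvPolynomial (Fin n) k), x = algebraMap _ (Localization.Away u)
      (Ideal.Quotient.mk J a) * IsLocalization.Away.invSelf u ^ j := by
  obtain ⟨⟨r, s⟩, rfl⟩ := IsLocalization.mk'_surjective (Submonoid.powers u) x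
  obtain ⟨j, hj⟩ := (Submonoid.mem_powers_iff _ _).mp s.2
  obtain ⟨a, rfl⟩ := Ideal.Quotient.mk_surjective r
  refine ⟨j, a, ?_⟩
  dsimp only
  rw [IsLocalization.mk'_eq_iff_eq_mul, mul_assoc, ← hj, map_pow, ← mul_pow, mul_comm (IsLocalization.Away.invSelf u),
    IsLocalization.Away.mul_invSelf, one_pow, mul_one]

section
include ha₀ hu hlam

/-- **Veronese saturation ⇒ the non-negative part lies in the chart.** Assume every monomial of weight `≥ K N`
lies in `I_N ^ K`. If `x ∈ L` has `λ x ∈ L[T]` (no negative exponents) then `x ∈ R[I_N R/u]`: writing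
`x = (ā/1)(1/u)^j` and splitting `a = a⁺ + a⁻` into the monomials of weight `≥ jN` and `< jN`, the part
`(ā⁺/1)(1/u)^j` lies in the chart (`a⁺ ∈ I_N^j` by saturation, Stacks 052Q), so `λ` of the other part is a polynomial
in `T` with only negative exponents, i.e. zero, whence that part vanishes (`T = 1`). [folklore] -/
theorem mem_blowupAlgebra_of_coaction_mem_range
    (hpow : ∀ (K : ℕ) (b : Fin n →₀ ℕ), K * N ≤ Finsupp.weight w b → (MvPolynomial.monomial b (1 : k) : MvPolynomial (Fin n) k) ∈
      (Ideal.span {m : MvPolynomial (Fin n) k | ∃ b : Fin n →₀ ℕ, N ≤ Finsupp.weight w b ∧ m = MvPolynomial.monomial b 1}) ^ K)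
    {x : Localization.Away u}
    (hx : lam x ∈ Set.range (Polynomial.toLaurent : Polynomial (Localization.Away u) → (Localization.Away u)[T;T⁻¹])) :
    x ∈ blowupAlgebra ((Ideal.span {m : MvPolynomial (Fin n) k | ∃ b : Fin n →₀ ℕ, N ≤ Finsupp.weight w b ∧
      m = MvPolynomial.monomial b 1}).map (Ideal.Quotient.mk J)) u := by
  classical
  obtain ⟨j, a, rfl⟩ := exists_eq_algebraMap_mk_mul_invSelf_pow J u x
  -- split `a` by weight `≥ jN` / `< jN`
  set sp := a.support.filter (fun b => j * N ≤ Finsupp.weight w b) with hsp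
  set sm := a.support.filter (fun b => ¬ j * N ≤ Finsupp.weight w b) with hsm
  have hsplit : a = (∑ b ∈ sp, MvPolynomial.monomial b (MvPolynomial.coeff b a)) +
      ∑ b ∈ sm, MvPolynomial.monomial b (MvPolynomial.coeff b a) := by
    conv_lhs => rw [MvPolynomial.as_sum a]
    exact (Finset.sum_filter_add_sum_filter_not a.support (fun b => j * N ≤ Finsupp.weight w b) _).symm
  -- the heavy part lies in the chart
  have hp_mem : algebraMap _ (Localization.Away u) (Ideal.Quotient.mk J
      (∑ b ∈ sp, MvPolynomial.monomial b (MvPolynomial.coeff b a))) * IsLocalization.Away.invSelf u ^ j ∈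
      blowupAlgebra ((Ideal.span {m : MvPolynomial (Fin n) k | ∃ b : Fin n →₀ ℕ, N ≤ Finsupp.weight w b ∧
        m = MvPolynomial.monomial b 1}).map (Ideal.Quotient.mk J)) u := by
    refine algebraMap_mul_invSelf_pow_mem_blowupAlgebra u j ?_
    rw [← Ideal.map_pow]
    refine Ideal.mem_map_of_mem _ (Ideal.sum_mem _ fun b hb => ?_)
    rw [hsp, Finset.mem_filter] at hb
    rw [← mul_one (MvPolynomial.coeff b a), ← MvPolynomial.C_mul_monomial]
    exact Ideal.mul_mem_left _ _ (hpow j b hb.2)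
  -- the light part: its coaction is a polynomial in `T` with only negative exponents
  have hexp : lam (algebraMap _ (Localization.Away u) (Ideal.Quotient.mk J
      (∑ b ∈ sm, MvPolynomial.monomial b (MvPolynomial.coeff b a))) * IsLocalization.Away.invSelf u ^ j) =
      ∑ b ∈ sm, C (algebraMap _ (Localization.Away u) (Ideal.Quotient.mk J
        (MvPolynomial.monomial b (MvPolynomial.coeff b a))) * IsLocalization.Away.invSelf u ^ j) *
          T ((Finsupp.weight w b : ℤ) - j * N) := by
    rw [map_sum, map_sum, Finset.sum_mul, map_sum]
    exact Finset.sum_congr rfl fun b _ => coaction_monomial_mul_invSelf_pow w J u ha₀ hu lam hlam b _ j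
  have hrange : lam (algebraMap _ (Localization.Away u) (Ideal.Quotient.mk J
      (∑ b ∈ sm, MvPolynomial.monomial b (MvPolynomial.coeff b a))) * IsLocalization.Away.invSelf u ^ j) ∈
      Set.range (Polynomial.toLaurent : Polynomial (Localization.Away u) → (Localization.Away u)[T;T⁻¹]) := by
    obtain ⟨P, hP⟩ := hx
    obtain ⟨Q, hQ⟩ := coaction_mem_range_toLaurent_of_mem_blowupAlgebra w J u ha₀ hu lam hlam hp_mem
    have hLsplit : algebraMap _ (Localization.Away u) (Ideal.Quotient.mk J a) * IsLocalization.Away.invSelf u ^ j =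
        algebraMap _ (Localization.Away u) (Ideal.Quotient.mk J
          (∑ b ∈ sp, MvPolynomial.monomial b (MvPolynomial.coeff b a))) * IsLocalization.Away.invSelf u ^ j +
        algebraMap _ (Localization.Away u) (Ideal.Quotient.mk J
          (∑ b ∈ sm, MvPolynomial.monomial b (MvPolynomial.coeff b a))) * IsLocalization.Away.invSelf u ^ j := by
      conv_lhs => rw [hsplit]
      rw [map_add, map_add, add_mul]
    refine ⟨P - Q, ?_⟩
    rw [map_sub, hP, hQ, ← map_sub, eq_sub_of_add_eq' hLsplit.symm]
  have hz := GradedChartIso.eq_zero_of_neg_support_of_mem_range sm _ (fun b => (Finsupp.weight w b : ℤ) - j * N) (fun b hb => by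
    rw [hsm, Finset.mem_filter] at hb
    have := hb.2
    omega) (hexp ▸ hrange)
  have hm_zero : algebraMap _ (Localization.Away u) (Ideal.Quotient.mk J
      (∑ b ∈ sm, MvPolynomial.monomial b (MvPolynomial.coeff b a))) * IsLocalization.Away.invSelf u ^ j = 0 := by
    rw [← eval₂_one_coaction w J u lam hlam (_ * _), hexp, hz, map_zero]
  rw [hsplit, map_add, map_add, add_mul, hm_zero, add_zero]
  exact hp_mem

end

/-! ## The degree-zero part `T₀` of `L[s]` and the chart isomorphism `C ≅ T₀` -/

/-- **The degree-`0` subalgebra `T₀ ⊆ L[s]`** (`deg s = -1`): the polynomials `∑ ℓᵢ sⁱ` with `ℓᵢ` homogeneous of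
degree `i`. It is a `k`-subalgebra: coefficients of a product are sums of products `ℓₐ ℓ'_b`, `a + b = i`,
homogeneous of degree `a + b`. [folklore] -/
theorem exists_degreeZeroSubalgebra (hlam : ∀ a : MvPolynomial (Fin n) k,
        lam (algebraMap (MvPolynomial (Fin n) k ⧸ J) _ (Ideal.Quotient.mk J a)) =
          MvPolynomial.aeval (fun j : Fin n => C (algebraMap (MvPolynomial (Fin n) k ⧸ J)
            (Localization.Away u) (Ideal.Quotient.mk J (MvPolynomial.X j))) * T (w j : ℤ)) a) :
    ∃ T₀ : Subalgebra k (Polynomial (Localization.Away u)), ∀ P : Polynomial (Localization.Away u),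
      P ∈ T₀ ↔ ∀ i : ℕ, lam (P.coeff i) = C (P.coeff i) * T (i : ℤ) := by
  classical
  refine ⟨{ carrier := {P | ∀ i : ℕ, lam (P.coeff i) = C (P.coeff i) * T (i : ℤ)}
            mul_mem' := ?_, one_mem' := ?_, add_mem' := ?_, zero_mem' := ?_, algebraMap_mem' := ?_ },
    fun P => Iff.rfl⟩
  · intro P Q hP hQ i
    rw [Polynomial.coeff_mul]
    refine isHomogeneous_sum lam _ _ _ fun x hx => ?_
    have h := isHomogeneous_mul lam (hP x.1) (hQ x.2)
    rw [Finset.mem_antidiagonal] at hx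
    rwa [← Nat.cast_add, hx] at h
  · intro i
    simp only [Polynomial.coeff_one]
    split_ifs
    · rw [map_one, map_one, one_mul]; subst i; exact T_zero.symm
    · rw [map_zero, map_zero, zero_mul]
  · intro P Q hP hQ i
    rw [Polynomial.coeff_add]
    exact isHomogeneous_add lam (hP i) (hQ i)
  · intro i
    rw [Polynomial.coeff_zero, map_zero, map_zero, zero_mul]
  · intro r i
    simp only [Polynomial.algebraMap_apply, Polynomial.coeff_C]
    split_ifs
    · subst i
      rw [Nat.cast_zero, T_zero, mul_one]
      exact coaction_algebraMap w J u lam hlam r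
    · rw [map_zero, map_zero, zero_mul]

section
include ha₀ hu hlam

/-- **THE CHART ISOMORPHISM `ι : C ≃ T₀`**, `c ↦ ∑ᵢ cᵢ sⁱ` (the truncation of `λ c ∈ L[T]`, read with `T = s`):
a `k`-algebra isomorphism from the affine blow-up algebra `C = R[I_N R/u]` onto the degree-`0` subalgebra
`T₀ ⊆ L[s]`, characterised by `ι c = λ c` in `L[T,T⁻¹]`. Multiplicativity because `λ` is a ring map and `L[s] → L[T,T⁻¹]`
is injective; injective because `T = 1` recovers `c`; image `= T₀` by homogeneity of components and Veronese
saturation (`∑ Pᵢ ∈ L_{≥0} = C` maps to `P`). [folklore] -/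
theorem exists_chartIso
    (hpow : ∀ (K : ℕ) (b : Fin n →₀ ℕ), K * N ≤ Finsupp.weight w b → (MvPolynomial.monomial b (1 : k) : MvPolynomial (Fin n) k) ∈
      (Ideal.span {m : MvPolynomial (Fin n) k | ∃ b : Fin n →₀ ℕ, N ≤ Finsupp.weight w b ∧ m = MvPolynomial.monomial b 1}) ^ K)
    (T₀ : Subalgebra k (Polynomial (Localization.Away u)))
    (hT₀ : ∀ P : Polynomial (Localization.Away u), P ∈ T₀ ↔ ∀ i : ℕ, lam (P.coeff i) = C (P.coeff i) * T (i : ℤ)) :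
    ∃ ι : blowupAlgebra ((Ideal.span {m : MvPolynomial (Fin n) k | ∃ b : Fin n →₀ ℕ, N ≤ Finsupp.weight w b ∧
        m = MvPolynomial.monomial b 1}).map (Ideal.Quotient.mk J)) u ≃ₐ[k] T₀,
      ∀ c, Polynomial.toLaurent ((ι c : T₀) : Polynomial (Localization.Away u)) = lam c := by
  classical
  set C' := blowupAlgebra ((Ideal.span {m : MvPolynomial (Fin n) k | ∃ b : Fin n →₀ ℕ, N ≤ Finsupp.weight w b ∧
        m = MvPolynomial.monomial b 1}).map (Ideal.Quotient.mk J)) u with hC'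
  -- on the chart, truncation loses nothing
  have htr : ∀ c : Localization.Away u, c ∈ C' → Polynomial.toLaurent (trunc (lam c)) = lam c := fun c hc => by
    obtain ⟨P, hP⟩ := coaction_mem_range_toLaurent_of_mem_blowupAlgebra w J u ha₀ hu lam hlam hc
    rw [← hP, Polynomial.trunc_toLaurent]
  -- the map `c ↦ trunc (λ c)` as a `k`-algebra hom `C → L[s]`
  let φ : C' →ₐ[k] Polynomial (Localization.Away u) :=
    { toFun := fun c => trunc (lam c)
      map_one' := Polynomial.toLaurent_injective (by
        rw [OneMemClass.coe_one, htr _ C'.one_mem, map_one, map_one])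
      map_mul' := fun x y => Polynomial.toLaurent_injective (by
        rw [MulMemClass.coe_mul, htr _ (C'.mul_mem x.2 y.2), map_mul, map_mul, htr _ x.2, htr _ y.2])
      map_zero' := Polynomial.toLaurent_injective (by
        rw [ZeroMemClass.coe_zero, htr _ C'.zero_mem, map_zero, map_zero])
      map_add' := fun x y => Polynomial.toLaurent_injective (by
        rw [AddMemClass.coe_add, htr _ (C'.add_mem x.2 y.2), map_add, map_add, htr _ x.2, htr _ y.2])
      commutes' := fun r => Polynomial.toLaurent_injective (by
        rw [Subalgebra.coe_algebraMap, coaction_algebraMap w J u lam hlam r, ← mul_one (C _), ← T_zero, trunc_C_mul_T,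
          if_pos le_rfl, Int.toNat_zero, Polynomial.toLaurent_C_mul_T, Polynomial.algebraMap_apply, Polynomial.toLaurent_C,
          Nat.cast_zero, T_zero, mul_one]) }
  have hφ : ∀ c : C', φ c = trunc (lam c) := fun c => rfl
  -- its image lies in `T₀`
  have hmemT : ∀ c : C', φ c ∈ T₀ := fun c => by
    rw [hT₀, hφ]
    intro i
    rw [← GradedChartIso.coeff_toLaurent_natCast, htr _ c.2]
    exact coaction_coeff w J u ha₀ hu lam hlam c i
  -- `T₀` is attained (Veronese saturation)
  have hsurj : ∀ P ∈ T₀, ∃ c : C', φ c = P := fun P hP => by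
    rw [hT₀] at hP
    have hx : lam (∑ i ∈ P.support, P.coeff i) = Polynomial.toLaurent P := by
      rw [map_sum, GradedChartIso.toLaurent_eq_sum]
      exact Finset.sum_congr rfl fun i _ => hP i
    refine ⟨⟨_, mem_blowupAlgebra_of_coaction_mem_range w J u ha₀ hu lam hlam hpow ⟨P, hx.symm⟩⟩, ?_⟩
    rw [hφ]
    show trunc (lam (∑ i ∈ P.support, P.coeff i)) = P
    rw [hx, Polynomial.trunc_toLaurent]
  -- injective (`T = 1`)
  have hinj : Function.Injective φ := fun x y hxy => by
    apply Subtype.ext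
    have h1 : lam (x : Localization.Away u) = lam (y : Localization.Away u) := by
      rw [← htr _ x.2, ← htr _ y.2, ← hφ, ← hφ, hxy]
    rw [← eval₂_one_coaction w J u lam hlam (x : Localization.Away u), h1, eval₂_one_coaction w J u lam hlam]
  refine ⟨AlgEquiv.ofBijective (φ.codRestrict T₀ hmemT) ⟨fun x y h => hinj (congrArg Subtype.val h), fun P => ?_⟩,
    fun c => ?_⟩
  · obtain ⟨c, hc⟩ := hsurj P.1 P.2
    exact ⟨c, Subtype.ext hc⟩
  · exact htr _ c.2

end

/-! ## Reading the chart isomorphism -/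

omit hlam in
/-- Coefficients of `ι c` are the weight components of `c`. [folklore] -/
theorem chartIso_coeff {I : Ideal (MvPolynomial (Fin n) k ⧸ J)}
    {T₀ : Subalgebra k (Polynomial (Localization.Away u))} (ι : blowupAlgebra I u ≃ₐ[k] T₀)
    (hι : ∀ c, Polynomial.toLaurent ((ι c : T₀) : Polynomial (Localization.Away u)) = lam c)
    (c : blowupAlgebra I u) (i : ℕ) :
    ((ι c : T₀) : Polynomial (Localization.Away u)).coeff i = (lam c).coeff (i : ℤ) := by
  rw [← GradedChartIso.coeff_toLaurent_natCast, hι]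

section
include ha₀ hu hlam

/-- `ι` sends the exceptional equation `u ∈ C` to `(u/1)·s^N`. [folklore] -/
theorem chartIso_algebraMap_u {I : Ideal (MvPolynomial (Fin n) k ⧸ J)}
    {T₀ : Subalgebra k (Polynomial (Localization.Away u))} (ι : blowupAlgebra I u ≃ₐ[k] T₀)
    (hι : ∀ c, Polynomial.toLaurent ((ι c : T₀) : Polynomial (Localization.Away u)) = lam c) :
    ((ι (algebraMap (MvPolynomial (Fin n) k ⧸ J) (blowupAlgebra I u) u) : T₀) :
        Polynomial (Localization.Away u)) =
      Polynomial.C (algebraMap _ (Localization.Away u) u) * Polynomial.X ^ N := by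
  apply Polynomial.toLaurent_injective
  rw [hι, Polynomial.toLaurent_C_mul_X_pow]
  exact coaction_algebraMap_u w J u ha₀ hu lam hlam

end

end Summit.ResolutionOfSingularities.ResolutionOfSingularities.Theorems.FInjectiveMacaulayfication.GradedDomainChartIso

end
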